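import Summits.Langlands.Langlands.Theorems.IrreducibilityBySelfDualityPairLBoundaryJSGapGlobalTranslateOf
import Summits.Langlands.Langlands.Theorems.IrreducibilityBySelfDualityPairLBoundaryJSGapAbsConvergence
import Summits.Langlands.Langlands.Theorems.IrreducibilityBySelfDualityPairLBoundaryJSGapEulerLimit
import Literature.NumberTheory.Automorphic.JPSSUnfoldedPairIntegralEntire

/-!
# The gap global theorem in TRANSLATE form for `GL_n × GL_m` — the registered stub `stub_gap_global_translate`

Summit `Langlands`, sub-problem `Langlands`, helper file under `Theorems/` supporting the crux `PairLBoundaryJS`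
(stmt-Langlands-13622), line `Sketch`, registered stub `stub_gap_global_translate` (G-GT) of the GAP ROAD (lead c6):
`GapGlobalTranslate.exists_entire_eq_translate_of` (file `…GapGlobalTranslateOf.lean`) with its three inputs supplied:
(E) the Literature named fact `Cogdell2004_unfoldedPairIntegral_entire n m K` (Cogdell (2004), Thm. 2.1, analytic
clause in unfolded form — a HYPOTHESIS of the stub, never proved), (Ac) `GapAbsConvergence.stub_gap_abs_convergence`,
(EL) `GapEulerLimit.stub_gap_euler_limit`. [cite: CogdellAnalyticTheory2004, §2.2 Thm. 2.1–2.2, §3.1 Thm. 3.3, §4.2]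

## References

* J. W. Cogdell, *Analytic theory of L-functions for GL_n*, in *An Introduction to the Langlands
  Program* (2004), §2.2 (PDF pp. 182–184), Thm. 2.1–2.2, §3.1 Thm. 3.3, §4.2 [CogdellAnalyticTheory2004].
-/


noncomputable section

-- `Summit.Langlands.Langlands.…` (summit = sub-problem name, D-0017 layout) trips `dupNamespace`
set_option linter.dupNamespace false

open scoped MatrixGroups Topology Pointwise ENNReal NNReal ComplexConjugate InnerProductSpace ContDiff
open scoped Classical Matrix.Norms.Operator
open NumberField IsDedekindDomain MeasureTheory Measure Matrix Set Filter WithZero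
open NumberField.mixedEmbedding
open Literature.NumberTheory.Automorphic AdelicGroupData
open Literature.NumberTheory.GaloisRepresentations (ideleGroup HeckeCharacter)
open Literature.MeasureTheory.Group
open Literature.RingTheory.SymmetricFunctions.SymmPoly
open ValuativeRel

-- the automorphic quotient carries the tree's Borel σ-algebra, not Mathlib's quotient σ-algebra
attribute [-instance] Quotient.instMeasurableSpace QuotientGroup.measurableSpace

-- the house local instances, exactly as in `RankinSelbergUnfoldingIdentity`
attribute [local instance] adelicBorel borelSpace_adelic locallyCompactSpace_adelic secondCountableTopology_gl_adelic
  glAdeleBorel borelSpace_glAdele borelSpace_ideleGroup secondCountableTopology_ideleGroup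

attribute [local instance 100] LieRing.ofAssociativeRing

namespace Summit.Langlands.Langlands.Theorems.GapGlobalTranslate

/-! ### The registered stub -/

/-- **STUB (G-GT) — the gap global theorem in TRANSLATE form at the torus parameter, GRANTED the analytic clause
(the Literature named fact `Cogdell2004_unfoldedPairIntegral_entire`)**: `exists_entire_eq_translate_of` with (E) the
named fact at the given measures, (Ac) `GapAbsConvergence.stub_gap_abs_convergence` and (EL)
`GapEulerLimit.stub_gap_euler_limit`. [cite: CogdellAnalyticTheory2004, §2.2 Thm. 2.1–2.2, §3.1 Thm. 3.3, §4.2] -/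
theorem stub_gap_global_translate :
    ∀ {n m : ℕ} {K : Type} [Field K] [NumberField K]
      [MeasurableSpace (AdeleRing (𝓞 K) K)] [BorelSpace (AdeleRing (𝓞 K) K)] (_hm : 0 < m) (hmn : m < n),
      Cogdell2004_unfoldedPairIntegral_entire n m K →
    ∀ (μ : Measure (AdelicGroupData.gl n K).automorphicQuotient)
      [(AdelicGroupData.gl n K).IsAutomorphicMeasure μ]
      (μ' : Measure (AdelicGroupData.gl m K).automorphicQuotient) [(AdelicGroupData.gl m K).IsAutomorphicMeasure μ']
      (νA : Measure (Fin m → ideleGroup K)) [IsHaarMeasure νA]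
      (νK : Measure ↥(maximalCompactAdelic m K)) [IsHaarMeasure νK]
      (ν₀ : Measure ↥(adelicUnipotent n K)) [IsHaarMeasure ν₀]
      (ν₀' : Measure ↥(adelicUnipotent m K)) [IsHaarMeasure ν₀']
      (P : CuspidalAutomorphicRepGL n K μ) (Q : CuspidalAutomorphicRepGL m K μ')
        {S : Set (HeightOneSpectrum (𝓞 K))} {α γ : SatakeFamily K},
        IsSatakeFamilyOf P S α → IsSatakeFamilyOf Q S γ →
      ∀ {Φ : (AdelicGroupData.gl n K).automorphicQuotient → ℂ}
        {Φ' : (AdelicGroupData.gl m K).automorphicQuotient → ℂ}, Continuous Φ → Continuous Φ' →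
      ∀ (sv : P.1.toSubmodule) (sv' : Q.1.toSubmodule),
        (((sv : (AdelicGroupData.gl n K).L2 μ) : (AdelicGroupData.gl n K).automorphicQuotient → ℂ)
          =ᵐ[μ] Φ) →
        (((sv' : (AdelicGroupData.gl m K).L2 μ') : (AdelicGroupData.gl m K).automorphicQuotient → ℂ) =ᵐ[μ'] Φ') →
        IsCuspFormGL n K (isCompact_glFiniteIntegralLevel_holds n K)
          (invQuot (AdelicGroupData.gl n K) Φ) →
        IsCuspFormGL m K (isCompact_glFiniteIntegralLevel_holds m K) (invQuot (AdelicGroupData.gl m K) Φ') →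
      ∀ {𝔫₀ : Ideal (𝓞 K)}, 𝔫₀ ≠ 0 →
        (∀ k ∈ principalCongruenceLevel n K 𝔫₀, ∀ y : GL (Fin n) (AdeleRing (𝓞 K) K),
          invQuot (AdelicGroupData.gl n K) Φ (y * k) = invQuot (AdelicGroupData.gl n K) Φ y) →
        (∀ k ∈ principalCongruenceLevel m K 𝔫₀, ∀ y : GL (Fin m) (AdeleRing (𝓞 K) K),
          invQuot (AdelicGroupData.gl m K) Φ' (y * k) = invQuot (AdelicGroupData.gl m K) Φ' y) →
      ∀ {S' : Set (HeightOneSpectrum (𝓞 K))}, S ⊆ S' → (∀ v ∉ S', ¬ v.asIdeal ∣ 𝔫₀) →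
      ∀ (τ : Fin m → ideleGroup K) (T : Fin n → ideleGroup K),
        (∀ i : Fin m, T (Fin.castLE hmn.le i) = τ i) →
        GLn.toMixed n K (glDiagonal n (AdeleRing (𝓞 K) K) T) = 1 →
        (∀ v ∉ S', ∃ (d : Fin n → (v.adicCompletion K)ˣ) (a : (v.adicCompletion K)ˣ),
          localComponent v (glDiagonal n (AdeleRing (𝓞 K) K) T) =
            diagonalGL (Fin n) (v.adicCompletion K) d ∧
          (∀ i j : Fin n, (i : ℕ) + 1 = j →
            (d i : v.adicCompletion K) * ((d j)⁻¹ : (v.adicCompletion K)ˣ) = a) ∧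
          (∀ c ∈ 𝒪[v.adicCompletion K], (adeleAddChar K).adicComponent v (a * c) = 1) ∧
          ∀ ϖ : v.adicCompletion K, Valued.v ϖ = WithZero.exp (-1 : ℤ) →
            ∃ c ∈ 𝒪[v.adicCompletion K], (adeleAddChar K).adicComponent v (a * (ϖ⁻¹ * c)) ≠ 1) →
        (∀ v ∉ S', ∃ (d : Fin m → (v.adicCompletion K)ˣ) (a : (v.adicCompletion K)ˣ),
          localComponent v (glDiagonal m (AdeleRing (𝓞 K) K) τ) =
            diagonalGL (Fin m) (v.adicCompletion K) d ∧
          (∀ i j : Fin m, (i : ℕ) + 1 = j →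
            (d i : v.adicCompletion K) * ((d j)⁻¹ : (v.adicCompletion K)ˣ) = a) ∧
          (∀ c ∈ 𝒪[v.adicCompletion K], (adeleAddChar K).adicComponent v (a * c) = 1) ∧
          ∀ ϖ : v.adicCompletion K, Valued.v ϖ = WithZero.exp (-1 : ℤ) →
            ∃ c ∈ 𝒪[v.adicCompletion K], (adeleAddChar K).adicComponent v (a * (ϖ⁻¹ * c)) ≠ 1) →
      ∀ {x : HeightOneSpectrum (𝓞 K) → Fin n → ℂ} {y : HeightOneSpectrum (𝓞 K) → Fin m → ℂ},
        (∀ v ∉ S', (Finset.univ : Finset (Fin n)).val.map (x v) = α v) →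
        (∀ v ∉ S', (Finset.univ : Finset (Fin m)).val.map (y v) = γ v) →
      ∃ (x₀ : ℝ) (J : ℂ → ℂ), Differentiable ℂ J ∧ ∀ s : ℂ, x₀ < s.re →
        J s = torusWeightC m K s τ *
            (partialPairL S' α (fun v => (γ v).map conj) (s + ((n : ℂ) - (m : ℂ)) / 2) *
              ∫ p in unitBox {v | v ∉ S'} ×ˢ Set.univ, torusPairIntegrandC m K
                (fun g => whittakerCoeff ν₀ (unipotentTateDomain n K) (adeleAddChar K)
                  (invQuot (AdelicGroupData.gl n K) Φ)
                  (glDiagonal n (AdeleRing (𝓞 K) K) T * glCorner (AdeleRing (𝓞 K) K) hmn.le g))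
                (fun g => star (whittakerCoeff ν₀' (unipotentTateDomain m K) (adeleAddChar K)
                  (invQuot (AdelicGroupData.gl m K) Φ') (glDiagonal m (AdeleRing (𝓞 K) K) τ * g)))
                (fun _ => (1 : ℝ)) s p ∂(νA.prod νK)) := by
  intro n m K _ _ _ _ hm hmn hE μ _ μ' _ νA _ νK _ ν₀ _ ν₀' _ P Q S α γ hα hγ Φ Φ' hΦc hΦ'c sv sv' hae hae' hcusp hcusp'
    𝔫₀ h𝔫₀ hΦU hΦ'U S' hSS' hGood τ T hTτ hTinf hTψ hτψ x y hx hy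
  exact exists_entire_eq_translate_of hm hmn μ μ' νA νK ν₀ ν₀' (hE hmn hm νA νK ν₀ ν₀')
    (GapAbsConvergence.stub_gap_abs_convergence hm hmn νA νK) (GapEulerLimit.stub_gap_euler_limit hm hmn νA νK)
    P Q hα hγ hΦc hΦ'c sv sv' hae hae' hcusp hcusp' h𝔫₀ hΦU hΦ'U hSS' hGood τ T hTτ hTinf hTψ hτψ hx hy

end Summit.Langlands.Langlands.Theorems.GapGlobalTranslate

end
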